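import Literature.MathematicalPhysics.QuantumFieldTheory.Balaban1983to89.B10LogDet63
import Summits.QuantumFields.YangMills.Theorems.BalabanUVNodesK0RecordFormatNames

/-!
# NODE O port PT-A — THE (R-c) LEAF OF THE `log Z^{(k)}` PACKAGING, ALGEBRAIC HALF (object-free): the power-series members `Tr Tᵐ` of [16] (63) AS WALK SUMS in `B10LogDet63` §3's
# vocabulary — `(Tᵐ)_{bb} = Σ_{ω ∈ walksFrom nbrs m (cube b)} powTerm T m b ω` for a matrix of FINITE RANGE in the cube adjacency, with the crude count `‖powTerm T m b ω‖ ≤ (V·t)ᵐ`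

Cell `ym-nodeO-ideate`, porter seat `ymgap-nodeO-port-PTA-1` (gen 7, lead of the line `pta-residueW` of 27930's skeleton v3.2); `--supports stmt-QuantumFields-27930` (helper).
[16] = [Balaban1985UV3], [B9] = [Balaban1985BackgroundPropagators], [I] = [Balaban1987RG1].

WHY.  The Gaussian bracket `stub_LZdet` of the skeleton (BLOCKED-ON the complex (2.11) carrier, LZDET-LOCATED-v1) is packaged by [16] (61)–(63): `−½ log det T = ½∫₀^{2γ₁} Tr(T + x)⁻¹ dx −
½ log(2γ₁)·Tr 1 + Σ_{m≥1} ((−1)ᵐ∕2m)(2γ₁)⁻ᵐ Tr Tᵐ` (✓ `B10LogDet63.matrix63`), and every member must be LOCALIZED — written as `Σ_n Σ_b Σ_{ω ∈ walksFrom nbrs n (cube b)} term b ω` with (23)-bounded walk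
terms, the currency of ✓ `B10LogDet63.logHalfBound_of_walks` ∕ `sum_Elog_eq` and of gen 3's ✓ `…PortS1WalkFamily` (which regroups a whole FAMILY `term_m` with summable coefficients into ONE
localized family).  The resolvent members come from the random-walk expansion ([B9] (3.90)); the POWER members `Tr Tᵐ` were LOCATED as «left unlocalized … needs Tr Tᵐ = Σ_X Elog_m X from a walk
expansion of T itself … M–L generic lemma, NOT in the tree» (LZ-SPEC-v1 §2 (R-c); WalkFamily's docstring: «the remaining leaf is the walk representation of (Tᵐ)_{bb}»).  THIS FILE is that leaf's
ALGEBRA, for any square matrix `T` over the sites `S` with a cube map `cube : S → Q` and FINITE RANGE in the adjacency `nbrs` (`T s s′ ≠ 0 → cube s′ ∈ nbrs (cube s)`; print: the fluctuation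
operator couples neighbouring blocks only):
* §1 `pathWeight T i l` (the product of entries along the site path `i, l₀, l₁, …`), `lastOr`, `listsLen m` (site lists of length `m`), ★ `pow_apply_eq_sum_paths` — `(Tᵐ) i j = Σ_{|l| = m,
  last = j} pathWeight T i l` (matrix power = sum over paths);
* §2 `powTerm cube T m b ω` (the paths from `b` back to `b` whose CUBE SEQUENCE is `ω`), `isChain_map_cube_of_pathWeight_ne_zero`, ★★ `pow_apply_diag_eq_sum_walks` — `(Tᵐ)_{bb} = Σ_{ω ∈
  walksFrom nbrs m (cube b)} powTerm … b ω` (✓ `B9Thm37Sum.mem_walksFrom`), ★ `trace_pow_eq_sum_walks`;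
* §3 `norm_pathWeight_le`, `card_filter_map_cube_le` (at most `Vᵐ` site lists over a given cube list), ★ `norm_powTerm_le` — `‖powTerm … m b ω‖ ≤ (V·t)ᵐ` for `‖T s s′‖ ≤ t`, `≤ V` sites per cube
  (the instantiation trades `(V t)ᵐ` against `(2γ₁)⁻ᵐ` and the (23) shape `K_m qᵐ e^{−r d(dom b ω)}`, `d(dom b ω) ≤ m + 1` cubes — consumer's bookkeeping).
NOT here: the analytic hypotheses at the record (entry bounds ∕ range of the complex (2.11) carrier — P0-ℂ), the choice of `q, r, K_m`, the resolvent members.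

HONEST FRAMING.  Finite linear algebra and counting ([folklore]; the (63)∕(3.90) cites are locators); NOTHING of Bałaban's estimates asserted, ported or discharged; `stub_LZdet` BLOCKED-ON P0-ℂ,
`stub_FE` XXL; 27930 ⁸-Ax-LR4 OPEN · 2∕4 stubs · no claim; K0⁷∕K-Ax OPEN; NODE O 0∕1; COUNT 8∕28 · K 1∕4 UNMOVED; finite `𝕋⁴_{L^K}` at fixed ε — NOT continuum ∕ OS ∕ Clay; **the Yang–Mills mass gap
is NOT proved by any of this.**  No `sorry`, no `instance`, no `notation`; three small `def`s (bookkeeping objects of the statement); standard axioms.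
-/

open scoped BigOperators
open Finset

namespace Summit.QuantumFields.YangMills.Theorems.BalabanUVNodesPortS1

open Literature.MathematicalPhysics.QuantumFieldTheory.Balaban1983to89

variable {S : Type} [Fintype S] [DecidableEq S]

/-! ## §1  Matrix powers as sums over site paths -/

/-- **The weight of the site path `i → l₀ → l₁ → ⋯`**: the product of the entries of `T` along it (`1` for the empty path). [cite: Balaban1985UV3, p.272 (after (63); bookkeeping)] -/
def pathWeight (T : Matrix S S ℂ) : S → List S → ℂ
  | _, [] => 1
  | i, s :: l => T i s * pathWeight T s l

/-- The endpoint of the path `i, l`: the last entry of `l`, or `i` if `l` is empty. [folklore] -/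
def lastOr : S → List S → S
  | i, [] => i
  | _, s :: l => lastOr s l

/-- The site lists of length `m` (as a `Finset`, built by prepending). [folklore] -/
def listsLen : ℕ → Finset (List S)
  | 0 => {[]}
  | m + 1 => Finset.univ.biUnion fun s : S => (listsLen m).image (List.cons s)

omit [Fintype S] [DecidableEq S] in
/-- Unfolding the weight of a non-empty path. [folklore] -/
@[simp] theorem pathWeight_cons (T : Matrix S S ℂ) (i s : S) (l : List S) : pathWeight T i (s :: l) = T i s * pathWeight T s l := rfl

omit [Fintype S] [DecidableEq S] in
/-- The empty path has weight `1`. [folklore] -/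
@[simp] theorem pathWeight_nil (T : Matrix S S ℂ) (i : S) : pathWeight T i [] = 1 := rfl

omit [Fintype S] [DecidableEq S] in
/-- Unfolding the endpoint. [folklore] -/
@[simp] theorem lastOr_cons (i s : S) (l : List S) : lastOr i (s :: l) = lastOr s l := rfl

omit [Fintype S] [DecidableEq S] in
/-- The endpoint of the empty path. [folklore] -/
@[simp] theorem lastOr_nil (i : S) : lastOr i ([] : List S) = i := rfl

/-- Membership in `listsLen m` is having length `m`. [folklore] -/
theorem mem_listsLen_iff : ∀ (m : ℕ) (l : List S), l ∈ listsLen m ↔ l.length = m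
  | 0, l => by simp [listsLen, List.length_eq_zero_iff]
  | m + 1, [] => by simp [listsLen]
  | m + 1, s :: l => by
    simp only [listsLen, mem_biUnion, mem_univ, true_and, mem_image, List.cons.injEq, List.length_cons, Nat.add_right_cancel_iff]
    constructor
    · rintro ⟨s', l', hl', rfl, rfl⟩
      exact (mem_listsLen_iff m l').1 hl'
    · intro h
      exact ⟨s, l, (mem_listsLen_iff m l).2 h, rfl, rfl⟩

omit [Fintype S] in
/-- The prepending images are pairwise disjoint (different heads). [folklore] -/
theorem pairwiseDisjoint_image_cons (A : Finset (List S)) :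
    (Set.univ : Set S).PairwiseDisjoint fun s : S => A.image (List.cons s) := by
  intro s _ s' _ hss'
  simp only [Function.onFun]
  rw [Finset.disjoint_left]
  rintro l hl hl'
  obtain ⟨a, _, rfl⟩ := mem_image.1 hl
  obtain ⟨a', _, h⟩ := mem_image.1 hl'
  exact hss' (List.cons.inj h).1.symm

/-- Summing over `listsLen (m+1)` = summing over the head and over `listsLen m`. [folklore] -/
theorem sum_listsLen_succ (m : ℕ) (f : List S → ℂ) :
    ∑ l ∈ listsLen (m + 1), f l = ∑ s : S, ∑ l ∈ listsLen m, f (s :: l) := by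
  show ∑ l ∈ Finset.univ.biUnion (fun s : S => (listsLen m).image (List.cons s)), f l = _
  rw [sum_biUnion (fun s hs s' hs' h => pairwiseDisjoint_image_cons (listsLen m) (Set.mem_univ s) (Set.mem_univ s') h)]
  refine sum_congr rfl fun s _ => ?_
  rw [sum_image fun l _ l' _ h => (List.cons.inj h).2]

/-- ★ **MATRIX POWER = SUM OVER SITE PATHS**: `(Tᵐ) i j = Σ_{|l| = m, lastOr i l = j} pathWeight T i l`. [cite: Balaban1985UV3, p.272 (after (63)); folklore] -/
theorem pow_apply_eq_sum_paths (T : Matrix S S ℂ) :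
    ∀ (m : ℕ) (i j : S), (T ^ m) i j = ∑ l ∈ listsLen m, if lastOr i l = j then pathWeight T i l else 0
  | 0, i, j => by
    simp only [pow_zero, listsLen, sum_singleton, lastOr_nil, pathWeight_nil, Matrix.one_apply]
  | m + 1, i, j => by
    rw [pow_succ', Matrix.mul_apply, sum_listsLen_succ]
    refine sum_congr rfl fun s _ => ?_
    rw [pow_apply_eq_sum_paths T m s j, mul_sum]
    refine sum_congr rfl fun l _ => ?_
    simp only [lastOr_cons, pathWeight_cons, mul_ite, mul_zero]

/-! ## §2  Regrouping the closed paths by their cube sequence: `(Tᵐ)_{bb}` as a sum over cube walks -/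

section Cubes

variable {Q : Type} [DecidableEq Q] (nbrs : Q → Finset Q) (cube : S → Q)

/-- **The walk term of the power member**: `powTerm cube T m b ω :=` the total weight of the closed site paths of length `m` from `b` to `b` whose CUBE SEQUENCE `(cube b, cube l₀, …)` is the cube
walk `ω` (the `term_m b ω` of gen 3's `…PortS1WalkFamily` for the member `Tr Tᵐ`). [cite: Balaban1985UV3, p.272 (after (63)); Balaban1985BackgroundPropagators, (3.90) p.409] -/
def powTerm (T : Matrix S S ℂ) (m : ℕ) (b : S) (ω : List Q) : ℂ :=
  ∑ l ∈ listsLen m, if lastOr b l = b ∧ (b :: l).map cube = ω then pathWeight T b l else 0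

omit [Fintype S] [DecidableEq S] [DecidableEq Q] in
/-- A path of non-zero weight through a FINITE-RANGE matrix projects to a chain of neighbouring cubes. [cite: Balaban1985BackgroundPropagators, (3.90) p.409 («□ᵢ ∩ □ᵢ₊₁ ≠ ∅»)] -/
theorem isChain_map_cube_of_pathWeight_ne_zero {T : Matrix S S ℂ} (hT : ∀ s s', T s s' ≠ 0 → cube s' ∈ nbrs (cube s)) :
    ∀ (l : List S) (i : S), pathWeight T i l ≠ 0 → List.IsChain (fun a c => c ∈ nbrs a) (cube i :: l.map cube)
  | [], i, _ => List.isChain_singleton _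
  | s :: l, i, h => by
    rw [pathWeight_cons] at h
    rw [List.map_cons]
    exact List.isChain_cons_cons.2 ⟨hT i s (left_ne_zero_of_mul h), isChain_map_cube_of_pathWeight_ne_zero hT l s (right_ne_zero_of_mul h)⟩

/-- The cube sequence of a path of length `m` and non-zero weight from `b` is a cube walk of `m` steps from `cube b`. [cite: Balaban1985BackgroundPropagators, (3.90) p.409] -/
theorem map_cube_mem_walksFrom {T : Matrix S S ℂ} (hT : ∀ s s', T s s' ≠ 0 → cube s' ∈ nbrs (cube s)) {m : ℕ} {l : List S}
    (hl : l ∈ listsLen m) (b : S) (h : pathWeight T b l ≠ 0) : (b :: l).map cube ∈ B9Thm37Sum.walksFrom nbrs m (cube b) := by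
  classical
  have hlen : (l.map cube).length = m := by rw [List.length_map, (mem_listsLen_iff m l).1 hl]
  rw [List.map_cons, ← hlen]
  exact B9Thm37Sum.mem_walksFrom nbrs _ _ (isChain_map_cube_of_pathWeight_ne_zero nbrs cube hT l b h)

/-- ★★ **THE DIAGONAL ENTRY OF A POWER OF A FINITE-RANGE MATRIX IS A SUM OVER CUBE WALKS**: `(Tᵐ)_{bb} = Σ_{ω ∈ walksFrom nbrs m (cube b)} powTerm cube T m b ω` — the walk representation of
the power members of (63) that `B10LogDet63.sum_Elog_eq` ∕ `…PortS1WalkFamily.sum_Elog_tsum_family_eq` consume. [cite: Balaban1985UV3, (63) p.272; Balaban1985BackgroundPropagators, (3.90) p.409] -/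
theorem pow_apply_diag_eq_sum_walks {T : Matrix S S ℂ} (hT : ∀ s s', T s s' ≠ 0 → cube s' ∈ nbrs (cube s)) (m : ℕ) (b : S) :
    (T ^ m) b b = ∑ ω ∈ B9Thm37Sum.walksFrom nbrs m (cube b), powTerm cube T m b ω := by
  classical
  unfold powTerm
  rw [sum_comm, pow_apply_eq_sum_paths]
  refine sum_congr rfl fun l hl => ?_
  by_cases hlast : lastOr b l = b
  · simp only [hlast, true_and, if_true]
    rw [sum_ite_eq (B9Thm37Sum.walksFrom nbrs m (cube b)) ((b :: l).map cube) (fun _ => pathWeight T b l)]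
    by_cases hw : pathWeight T b l = 0
    · simp only [hw, ite_self]
    · rw [if_pos (map_cube_mem_walksFrom nbrs cube hT hl b hw)]
  · simp only [hlast, false_and, if_false, sum_const_zero]

/-- ★ **`Tr Tᵐ` AS A WALK SUM**: `trace (Tᵐ) = Σ_b Σ_{ω ∈ walksFrom nbrs m (cube b)} powTerm cube T m b ω` — the right-hand side of `B10LogDet63.sum_level_eq` for the term family
`term_m b ω := powTerm cube T m b ω`. [cite: Balaban1985UV3, (63) p.272] -/
theorem trace_pow_eq_sum_walks {T : Matrix S S ℂ} (hT : ∀ s s', T s s' ≠ 0 → cube s' ∈ nbrs (cube s)) (m : ℕ) :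
    Matrix.trace (T ^ m) = ∑ b : S, ∑ ω ∈ B9Thm37Sum.walksFrom nbrs m (cube b), powTerm cube T m b ω := by
  simp only [Matrix.trace, Matrix.diag_apply]
  exact sum_congr rfl fun b _ => pow_apply_diag_eq_sum_walks nbrs cube hT m b

end Cubes

/-! ## §3  The crude bound: at most `Vᵐ` site paths over a cube walk, each of weight at most `tᵐ` -/

omit [Fintype S] [DecidableEq S] in
/-- `‖pathWeight T i l‖ ≤ t^{|l|}` when every entry is bounded by `t ≥ 0`. [folklore] -/
theorem norm_pathWeight_le {T : Matrix S S ℂ} {t : ℝ} (ht0 : 0 ≤ t) (ht : ∀ s s', ‖T s s'‖ ≤ t) :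
    ∀ (l : List S) (i : S), ‖pathWeight T i l‖ ≤ t ^ l.length
  | [], i => by simp
  | s :: l, i => by
    rw [pathWeight_cons, norm_mul, List.length_cons, pow_succ']
    exact mul_le_mul (ht i s) (norm_pathWeight_le ht0 ht l s) (norm_nonneg _) ht0

section Count

variable {Q : Type} [DecidableEq Q] (cube : S → Q)

/-- **AT MOST `Vᵐ` SITE LISTS OVER A GIVEN CUBE LIST**: if every cube carries at most `V` sites, the site lists of length `m` with prescribed cube sequence `w` number at most `Vᵐ`. [folklore] -/
theorem card_filter_map_cube_le {V : ℕ} (hV : ∀ c : Q, (univ.filter fun s : S => cube s = c).card ≤ V) :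
    ∀ (m : ℕ) (w : List Q), ((listsLen (S := S) m).filter fun l => l.map cube = w).card ≤ V ^ m
  | 0, w => by
    refine (card_le_card (filter_subset _ _)).trans ?_
    simp [listsLen]
  | m + 1, [] => by
    rw [Finset.card_eq_zero.2, pow_succ]
    · exact Nat.zero_le _
    · refine filter_eq_empty_iff.2 fun l hl => ?_
      have hlen := (mem_listsLen_iff (m + 1) l).1 hl
      intro h
      have := congrArg List.length h
      rw [List.length_map, hlen] at this
      exact Nat.succ_ne_zero m this
  | m + 1, c :: w => by
    have hsub : ((listsLen (S := S) (m + 1)).filter fun l => l.map cube = c :: w) ⊆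
        (univ.filter fun s : S => cube s = c).biUnion fun s => (((listsLen m).filter fun l => l.map cube = w).image (List.cons s)) := by
      intro l hl
      rw [mem_filter] at hl
      obtain ⟨hl, hmap⟩ := hl
      have hlen := (mem_listsLen_iff (m + 1) l).1 hl
      match l, hlen, hmap with
      | s :: l', hlen', hmap' =>
        rw [List.map_cons, List.cons.injEq] at hmap'
        rw [mem_biUnion]
        refine ⟨s, mem_filter.2 ⟨mem_univ _, hmap'.1⟩, mem_image.2 ⟨l', mem_filter.2 ⟨(mem_listsLen_iff m l').2 (by simpa using hlen'), hmap'.2⟩, rfl⟩⟩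
    refine (card_le_card hsub).trans (card_biUnion_le.trans ?_)
    calc ∑ s ∈ univ.filter (fun s : S => cube s = c), (((listsLen m).filter fun l => l.map cube = w).image (List.cons s)).card
        ≤ ∑ _s ∈ univ.filter (fun s : S => cube s = c), V ^ m :=
          sum_le_sum fun s _ => card_image_le.trans (card_filter_map_cube_le hV m w)
      _ = (univ.filter fun s : S => cube s = c).card * V ^ m := by rw [sum_const, smul_eq_mul]
      _ ≤ V * V ^ m := Nat.mul_le_mul_right _ (hV c)
      _ = V ^ (m + 1) := by ring

/-- ★ **THE CRUDE BOUND ON THE POWER WALK TERM**: `‖powTerm cube T m b ω‖ ≤ (V·t)ᵐ` for `‖T s s′‖ ≤ t` and at most `V` sites per cube (at most `Vᵐ` closed site paths over the cube walk `ω`, each of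
weight at most `tᵐ`).  The consumer trades this against `(2γ₁)⁻ᵐ∕2m` and the (23) shape. [cite: Balaban1985UV3, (23) p.262, p.272 (after (63))] -/
theorem norm_powTerm_le {T : Matrix S S ℂ} {t : ℝ} (ht0 : 0 ≤ t) (ht : ∀ s s', ‖T s s'‖ ≤ t) {V : ℕ}
    (hV : ∀ c : Q, (univ.filter fun s : S => cube s = c).card ≤ V) (m : ℕ) (b : S) (ω : List Q) :
    ‖powTerm cube T m b ω‖ ≤ ((V : ℝ) * t) ^ m := by
  unfold powTerm
  have hstep : ∀ l ∈ listsLen (S := S) m, ‖(if lastOr b l = b ∧ (b :: l).map cube = ω then pathWeight T b l else 0)‖ ≤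
      if l.map cube = ω.tail ∧ ω.head? = some (cube b) then t ^ m else 0 := by
    intro l hl
    by_cases h : lastOr b l = b ∧ (b :: l).map cube = ω
    · rw [if_pos h]
      have hω : l.map cube = ω.tail ∧ ω.head? = some (cube b) := by
        rw [← h.2, List.map_cons]; exact ⟨rfl, rfl⟩
      rw [if_pos hω, ← (mem_listsLen_iff m l).1 hl]
      exact norm_pathWeight_le ht0 ht l b
    · rw [if_neg h, norm_zero]
      split_ifs
      · positivity
      · exact le_rfl
  refine (norm_sum_le _ _).trans ((sum_le_sum hstep).trans ?_)
  by_cases hhead : ω.head? = some (cube b)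
  · simp only [hhead, and_true]
    rw [← sum_filter, sum_const, nsmul_eq_mul, mul_pow]
    refine mul_le_mul_of_nonneg_right ?_ (pow_nonneg ht0 m)
    exact_mod_cast card_filter_map_cube_le cube hV m ω.tail
  · simp only [hhead, and_false, if_false, sum_const_zero]
    positivity

end Count

end Summit.QuantumFields.YangMills.Theorems.BalabanUVNodesPortS1
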